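import Mathlib
import Summits.ResolutionOfSingularities.ResolutionOfSingularities.Theorems.WeightedInvariantLocalWeightedDropTOT2BranchBirational
import Summits.ResolutionOfSingularities.ResolutionOfSingularities.Theorems.WeightedInvariantLocalWeightedDropTOT2ConflictBudgetDefs

/-!
# TOT2-LINE (P3) brick B3, part 2/2: CHART INVARIANCE OF THE CANONICAL BRANCH VALUATION `TOT2Branch.branchVal`

Sub-problem `ResolutionOfSingularities`, ENGINE crux `stmt-ResolutionOfSingularities-8899` (`LocalWeightedDrop`), skeleton v35
(2e806da509994632), registered stub `stub_conflictBudget` (P3); brick B3 of `L/res-L1-w43-stub-2/g6/CONFLICT-BUDGET-DESIGN-v1.md` §6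
(owner res-L1-w43-stub-2 g6; this hand res-L1-w43-stub-1 g7).  [OURS · L1 W4.3 · chain w43.  Engine bookkeeping: nothing here is a
statement of any manuscript; AI-produced, gate-checked, weaker than expert review.  «[OURS · L1 W4.3] replaces the role of nothing printed;
NOT a statement of the manuscript.»]

For `R₃ = k⟦X₀,X₁,X₂⟧`, a prime `P′` and a ring map `Φ : R₃ → R₃`, put `P := comap Φ P′`.  Then `v_{P′} ∘ Φ = v_P` on `R₃`
(`TOT2Branch.branchVal`; design v1 §1 (D4) «`R₃⧸P ↪ R₃⧸P′` is finite, injective, birational ⇒ same normalisation»):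
* `branchVal_comap_ringEquiv` / `branchVal_comap_algEquiv` — for every ring AUTOMORPHISM `Φ` (shears `(u₁, u₂ + u₁h(u₁), y)`, re-centrings
  `y ↦ y + ψ(u)`, the swap), unconditionally (both sides are junk simultaneously);
* **`branchVal_comap_eq`** — the owner's split v1 statement VERBATIM (`L/res-L1-w43-stub-2/g6/P3_split_v1.lean` 7fbb6274b2c57d05): a `k`-algebra
  endomorphism `Φ`, `P′` one-dimensional, `𝔪^N ⊆ P′ + Φ(𝔪)R₃` (`hprim`) and every variable a ratio of `Φ`-images modulo `P′` (`hbir`) ⇒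
  `dim R₃ ⧸ comap Φ P′ = 1 ∧ ∀ f, branchVal (comap Φ P′) f = branchVal P′ (Φ f)` (part 1 `quotientMap_finite_birational` +
  `addVal_integralClosure_eq_of_birational`); `isDiscreteValuationRing_integralClosure_comap`;
* `branchVal_comap_monomialChart`, `branchVal_comap_substAlgHom` and the four named instances `branchVal_comap_chartOne` (`![X 0, X 0 * X 1, X 0 * X 2]`),
  `branchVal_comap_chartTwo` (`![X 0 * X 1, X 1, X 1 * X 2]`), `branchVal_comap_chartDivOne` (`![X 0, X 1, X 0 * X 2]`), `branchVal_comap_chartDivTwo`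
  (`![X 0, X 1, X 1 * X 2]`) in the spelling of split v1 B4-1..4 (`P′.comap (substAlgHom ha)`, any `ha` by proof irrelevance): the hypotheses
  `hprim`, `hbir` hold for a MONOMIAL CHART (`Φ` fixes the exceptional variable `X j ∉ P′` and multiplies every other variable by `1` or `X j`)
  above every one-dimensional prime, by part 1 `exists_maximalIdeal_pow_le_sup_map`.
-/

set_option linter.dupNamespace false -- mandated namespace of this single-conjunct summit

noncomputable section

namespace Summit.ResolutionOfSingularities.ResolutionOfSingularities.Theorems

namespace TOT2Branch

open MvPowerSeries IsLocalRing

variable {k : Type} [Field k]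

/-- `branchVal P f = ⊤` when the normalisation of the branch ring is not a discrete valuation ring (junk case). -/
theorem branchVal_of_not_isDiscreteValuationRing {P : Ideal (MvPowerSeries (Fin 3) k)} [P.IsPrime]
    (hW : ¬ IsDiscreteValuationRing
      (integralClosure (MvPowerSeries (Fin 3) k ⧸ P) (FractionRing (MvPowerSeries (Fin 3) k ⧸ P))))
    (f : MvPowerSeries (Fin 3) k) : branchVal P f = ⊤ := by
  rw [branchVal, dif_pos ‹P.IsPrime›, dif_neg hW]

/-! ## Ring automorphisms -/

/-- A prime is the image of its comap along a ring automorphism; so the comap of a non-prime ideal is not prime. -/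
theorem isPrime_of_isPrime_comap_ringEquiv (σ : MvPowerSeries (Fin 3) k ≃+* MvPowerSeries (Fin 3) k)
    {P' : Ideal (MvPowerSeries (Fin 3) k)}
    (hP : (P'.comap (σ : MvPowerSeries (Fin 3) k →+* MvPowerSeries (Fin 3) k)).IsPrime) : P'.IsPrime := by
  have h := Ideal.map_isPrime_of_equiv σ (I := P'.comap (σ : MvPowerSeries (Fin 3) k →+* MvPowerSeries (Fin 3) k))
  rwa [Ideal.comap_coe, Ideal.map_comap_of_surjective σ σ.surjective] at h

/-- **CHART INVARIANCE ALONG RING AUTOMORPHISMS** (shears, re-centrings, the swap): `v_{comap σ P′}(f) = v_{P′}(σ f)`, unconditionally. -/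
theorem branchVal_comap_ringEquiv (σ : MvPowerSeries (Fin 3) k ≃+* MvPowerSeries (Fin 3) k)
    (P' : Ideal (MvPowerSeries (Fin 3) k)) (f : MvPowerSeries (Fin 3) k) :
    branchVal (P'.comap (σ : MvPowerSeries (Fin 3) k →+* MvPowerSeries (Fin 3) k)) f = branchVal P' (σ f) := by
  by_cases hP' : P'.IsPrime
  swap
  · have hP : ¬ (P'.comap (σ : MvPowerSeries (Fin 3) k →+* MvPowerSeries (Fin 3) k)).IsPrime :=
      fun h => hP' (isPrime_of_isPrime_comap_ringEquiv σ h)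
    rw [branchVal_of_not_isPrime hP, branchVal_of_not_isPrime hP']
  haveI := hP'
  haveI : (P'.comap (σ : MvPowerSeries (Fin 3) k →+* MvPowerSeries (Fin 3) k)).IsPrime := Ideal.comap_isPrime _ _
  let τ : MvPowerSeries (Fin 3) k ⧸ P'.comap (σ : MvPowerSeries (Fin 3) k →+* MvPowerSeries (Fin 3) k) ≃+*
      MvPowerSeries (Fin 3) k ⧸ P' :=
    Ideal.quotientEquiv _ P' σ (Ideal.map_comap_of_surjective (σ : MvPowerSeries (Fin 3) k →+* MvPowerSeries (Fin 3) k) σ.surjective P').symm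
  have hτ : ∀ g, τ (Ideal.Quotient.mk _ g) = Ideal.Quotient.mk P' (σ g) := fun g => rfl
  by_cases hW' : IsDiscreteValuationRing
      (integralClosure (MvPowerSeries (Fin 3) k ⧸ P') (FractionRing (MvPowerSeries (Fin 3) k ⧸ P')))
  · have hW := (isDiscreteValuationRing_integralClosure_iff_of_ringEquiv τ).mpr hW'
    rw [branchVal_eq hW, branchVal_eq hW', ← hτ]
    exact (addVal_integralClosure_eq_of_ringEquiv τ hW hW' _).symm
  · have hW : ¬ IsDiscreteValuationRing (integralClosure (MvPowerSeries (Fin 3) k ⧸ P'.comap (σ : MvPowerSeries (Fin 3) k →+* MvPowerSeries (Fin 3) k))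
        (FractionRing (MvPowerSeries (Fin 3) k ⧸ P'.comap (σ : MvPowerSeries (Fin 3) k →+* MvPowerSeries (Fin 3) k)))) :=
      fun h => hW' ((isDiscreteValuationRing_integralClosure_iff_of_ringEquiv τ).mp h)
    rw [branchVal_of_not_isDiscreteValuationRing hW, branchVal_of_not_isDiscreteValuationRing hW']

/-- The same for a `k`-algebra automorphism. -/
theorem branchVal_comap_algEquiv (σ : MvPowerSeries (Fin 3) k ≃ₐ[k] MvPowerSeries (Fin 3) k)
    (P' : Ideal (MvPowerSeries (Fin 3) k)) (f : MvPowerSeries (Fin 3) k) :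
    branchVal (P'.comap (σ : MvPowerSeries (Fin 3) k →+* MvPowerSeries (Fin 3) k)) f = branchVal P' (σ f) :=
  branchVal_comap_ringEquiv σ.toRingEquiv P' f

/-! ## Chart endomorphisms (the owner's split v1 statement `branchVal_comap_eq`, verbatim) -/

/-- Along a chart endomorphism (hypotheses `hprim`, `hbir` of `quotientMap_finite_birational`) and above a one-dimensional prime, the
normalisation of `R₃ ⧸ comap Φ P′` is a discrete valuation ring. -/
theorem isDiscreteValuationRing_integralClosure_comap (Φ : MvPowerSeries (Fin 3) k →ₐ[k] MvPowerSeries (Fin 3) k)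
    (P' : Ideal (MvPowerSeries (Fin 3) k)) [P'.IsPrime] (hdim' : ringKrullDim (MvPowerSeries (Fin 3) k ⧸ P') = 1)
    (hprim : ∃ N : ℕ, maximalIdeal (MvPowerSeries (Fin 3) k) ^ N ≤ P' ⊔ (maximalIdeal (MvPowerSeries (Fin 3) k)).map Φ)
    (hbir : ∀ i : Fin 3, ∃ g t : MvPowerSeries (Fin 3) k, Φ t ∉ P' ∧ Φ g - Φ t * X i ∈ P') :
    IsDiscreteValuationRing
      (integralClosure (MvPowerSeries (Fin 3) k ⧸ P'.comap Φ) (FractionRing (MvPowerSeries (Fin 3) k ⧸ P'.comap Φ))) := by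
  obtain ⟨hint, hb⟩ := quotientMap_finite_birational Φ P' hprim hbir
  exact isDiscreteValuationRing_integralClosure_of_birational _ Ideal.quotientMap_injective hb hint
    (isDiscreteValuationRing_integralClosure P' hdim')

/-- **B3 — FINITE BIRATIONAL COMPARISON OF BRANCH VALUATIONS** (split v1 `L/res-L1-w43-stub-2/g6/P3_split_v1.lean` 7fbb6274b2c57d05, statement
verbatim).  `Φ` a local endomorphism of `k⟦X₀,X₁,X₂⟧` (variables to the maximal ideal, constants fixed — the locality hypothesis is automatic for
`k`-algebra endomorphisms and not used), `P'` a one-dimensional prime with `P' + Φ(𝔪)R₃` primary to `𝔪` (`hprim`) and every variable a ratio of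
`Φ`-images modulo `P'` (`hbir`): then `P := Φ⁻¹(P')` is one-dimensional and `v_P = v_{P'} ∘ Φ`. -/
theorem branchVal_comap_eq (Φ : MvPowerSeries (Fin 3) k →ₐ[k] MvPowerSeries (Fin 3) k)
    (_hΦ : ∀ i : Fin 3, Φ (X i) ∈ maximalIdeal (MvPowerSeries (Fin 3) k))
    (P' : Ideal (MvPowerSeries (Fin 3) k)) [P'.IsPrime] (hdim' : ringKrullDim (MvPowerSeries (Fin 3) k ⧸ P') = 1)
    (hprim : ∃ N : ℕ, maximalIdeal (MvPowerSeries (Fin 3) k) ^ N ≤ P' ⊔ (maximalIdeal (MvPowerSeries (Fin 3) k)).map Φ)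
    (hbir : ∀ i : Fin 3, ∃ g t : MvPowerSeries (Fin 3) k, Φ t ∉ P' ∧ Φ g - Φ t * X i ∈ P') :
    ringKrullDim (MvPowerSeries (Fin 3) k ⧸ P'.comap Φ) = 1 ∧
      ∀ f : MvPowerSeries (Fin 3) k, branchVal (P'.comap Φ) f = branchVal P' (Φ f) := by
  refine ⟨ringKrullDim_quotient_comap_eq_one Φ P' hdim' hprim hbir, fun f => ?_⟩
  haveI : (P'.comap Φ).IsPrime := Ideal.comap_isPrime _ _
  obtain ⟨hint, hb⟩ := quotientMap_finite_birational Φ P' hprim hbir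
  have hW' := isDiscreteValuationRing_integralClosure P' hdim'
  have hW := isDiscreteValuationRing_integralClosure_comap Φ P' hdim' hprim hbir
  have hmk : Ideal.Quotient.mk P' (Φ f) =
      Ideal.quotientMap P' (Φ : MvPowerSeries (Fin 3) k →+* MvPowerSeries (Fin 3) k) le_rfl (Ideal.Quotient.mk _ f) := by
    rw [Ideal.quotientMap_mk]; rfl
  rw [branchVal_eq hW, branchVal_eq hW', hmk]
  exact (addVal_integralClosure_eq_of_birational _ Ideal.quotientMap_injective hb hint hW hW' _).symm

/-- The locality hypothesis of `branchVal_comap_eq` holds for every `k`-algebra endomorphism. -/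
theorem algHom_X_mem_maximalIdeal (Φ : MvPowerSeries (Fin 3) k →ₐ[k] MvPowerSeries (Fin 3) k) (i : Fin 3) :
    Φ (X i) ∈ maximalIdeal (MvPowerSeries (Fin 3) k) :=
  Literature.RingTheory.MvPowerSeries.Jets.algHom_apply_mem_maximalIdeal Φ
    (Literature.AlgebraicGeometry.Resolution.X_mem_maximalIdeal k (Fin 3) i)

/-! ## The monomial charts -/

/-- **THE MONOMIAL CHARTS.**  If `Φ` fixes `X j` and sends every variable `X i` to `X i` or to `X j · X i` (the origin charts
`(u₁, u₁u₂, u₁y)`, `(u₁u₂, u₂, u₂y)` of the point blow-up; the curve charts `(u₁, u₂, u₁y)`, `(u₁, u₂, u₂y)`), then the hypotheses `hprim`, `hbir` of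
`branchVal_comap_eq` hold above every one-dimensional prime `P′ ∌ X j`; so `dim R₃ ⧸ comap Φ P′ = 1` and `v_{comap Φ P′}(f) = v_{P′}(Φ f)`. -/
theorem branchVal_comap_monomialChart (Φ : MvPowerSeries (Fin 3) k →ₐ[k] MvPowerSeries (Fin 3) k) (j : Fin 3)
    (hfix : Φ (X j) = X j) (hmon : ∀ i : Fin 3, Φ (X i) = X i ∨ Φ (X i) = X j * X i)
    (P' : Ideal (MvPowerSeries (Fin 3) k)) [P'.IsPrime] (hdim' : ringKrullDim (MvPowerSeries (Fin 3) k ⧸ P') = 1)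
    (hj : (X j : MvPowerSeries (Fin 3) k) ∉ P') :
    ringKrullDim (MvPowerSeries (Fin 3) k ⧸ P'.comap Φ) = 1 ∧
      ∀ f : MvPowerSeries (Fin 3) k, branchVal (P'.comap Φ) f = branchVal P' (Φ f) := by
  have hu : Φ (X j) ∉ P' := by rw [hfix]; exact hj
  refine branchVal_comap_eq Φ (algHom_X_mem_maximalIdeal Φ) P' hdim'
    (exists_maximalIdeal_pow_le_sup_map Φ P' hdim' (Literature.AlgebraicGeometry.Resolution.X_mem_maximalIdeal k (Fin 3) j) hu)
    (fun i => ?_)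
  rcases hmon i with h | h
  · exact ⟨X i, 1, by rw [map_one]; exact fun h1 => hj (by simpa using Ideal.mul_mem_left P' (X j) h1), by
      rw [map_one, one_mul, h, sub_self]; exact zero_mem _⟩
  · exact ⟨X i, X j, hu, by rw [hfix, h, sub_self]; exact zero_mem _⟩

/-- The comap along a monomial chart does not contain `X j` and is not the maximal ideal. -/
theorem X_not_mem_comap_monomialChart (Φ : MvPowerSeries (Fin 3) k →ₐ[k] MvPowerSeries (Fin 3) k) (j : Fin 3)
    (hfix : Φ (X j) = X j) (P' : Ideal (MvPowerSeries (Fin 3) k)) (hj : (X j : MvPowerSeries (Fin 3) k) ∉ P') :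
    (X j : MvPowerSeries (Fin 3) k) ∉ P'.comap Φ ∧ P'.comap Φ ≠ maximalIdeal (MvPowerSeries (Fin 3) k) := by
  have h1 : (X j : MvPowerSeries (Fin 3) k) ∉ P'.comap Φ := by
    rw [Ideal.mem_comap, hfix]; exact hj
  exact ⟨h1, fun h => h1 (h ▸ Literature.AlgebraicGeometry.Resolution.X_mem_maximalIdeal k (Fin 3) j)⟩

/-- **THE MONOMIAL CHARTS AS SUBSTITUTIONS.**  For a substitutable triple `a` with `a j = X j` and `a i ∈ {X i, X j · X i}`:
`dim R₃ ⧸ comap (subst a) P′ = 1` and `v_{comap (subst a) P′}(f) = v_{P′}(f(a))` for every one-dimensional prime `P′ ∌ X j`. -/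
theorem branchVal_comap_substAlgHom {a : Fin 3 → MvPowerSeries (Fin 3) k} (ha : HasSubst a) (j : Fin 3)
    (hfix : a j = X j) (hmon : ∀ i : Fin 3, a i = X i ∨ a i = X j * X i)
    (P' : Ideal (MvPowerSeries (Fin 3) k)) [P'.IsPrime] (hdim' : ringKrullDim (MvPowerSeries (Fin 3) k ⧸ P') = 1)
    (hj : (X j : MvPowerSeries (Fin 3) k) ∉ P') :
    ringKrullDim (MvPowerSeries (Fin 3) k ⧸ P'.comap (substAlgHom ha : MvPowerSeries (Fin 3) k →ₐ[k] MvPowerSeries (Fin 3) k)) = 1 ∧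
      ∀ f : MvPowerSeries (Fin 3) k, branchVal (P'.comap (substAlgHom ha : MvPowerSeries (Fin 3) k →ₐ[k] MvPowerSeries (Fin 3) k)) f = branchVal P' (subst a f) := by
  have hX : ∀ i, (substAlgHom ha : MvPowerSeries (Fin 3) k →ₐ[k] MvPowerSeries (Fin 3) k) (X i : MvPowerSeries (Fin 3) k) = a i :=
    fun i => by rw [substAlgHom_apply, subst_X ha]
  obtain ⟨h1, h2⟩ := branchVal_comap_monomialChart (substAlgHom ha : MvPowerSeries (Fin 3) k →ₐ[k] MvPowerSeries (Fin 3) k) j (by rw [hX, hfix])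
    (fun i => by rw [hX]; exact hmon i) P' hdim' hj
  exact ⟨h1, fun f => by rw [← substAlgHom_apply ha f]; exact h2 f⟩

/-- **B3 for the `u₁`-CHART of the point blow-up** `chartOne = ![X 0, X 0 * X 1, X 0 * X 2]` (split v1 B4-1 spelling): above every
one-dimensional prime `P′ ∌ X 0`. -/
theorem branchVal_comap_chartOne (ha : HasSubst (![X 0, X 0 * X 1, X 0 * X 2] : Fin 3 → MvPowerSeries (Fin 3) k))
    (P' : Ideal (MvPowerSeries (Fin 3) k)) [P'.IsPrime] (hdim' : ringKrullDim (MvPowerSeries (Fin 3) k ⧸ P') = 1)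
    (hX : (X 0 : MvPowerSeries (Fin 3) k) ∉ P') :
    ringKrullDim (MvPowerSeries (Fin 3) k ⧸ P'.comap (substAlgHom ha : MvPowerSeries (Fin 3) k →ₐ[k] MvPowerSeries (Fin 3) k)) = 1 ∧
      ∀ f : MvPowerSeries (Fin 3) k, branchVal (P'.comap (substAlgHom ha : MvPowerSeries (Fin 3) k →ₐ[k] MvPowerSeries (Fin 3) k)) f = branchVal P' (subst ![X 0, X 0 * X 1, X 0 * X 2] f) :=
  branchVal_comap_substAlgHom ha 0 (by simp) (fun i => by fin_cases i <;> simp) P' hdim' hX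

/-- **B3 for the `u₂`-CHART of the point blow-up** `chartTwo = ![X 0 * X 1, X 1, X 1 * X 2]` (split v1 B4-2 spelling): above every
one-dimensional prime `P′ ∌ X 1`. -/
theorem branchVal_comap_chartTwo (ha : HasSubst (![X 0 * X 1, X 1, X 1 * X 2] : Fin 3 → MvPowerSeries (Fin 3) k))
    (P' : Ideal (MvPowerSeries (Fin 3) k)) [P'.IsPrime] (hdim' : ringKrullDim (MvPowerSeries (Fin 3) k ⧸ P') = 1)
    (hX : (X 1 : MvPowerSeries (Fin 3) k) ∉ P') :
    ringKrullDim (MvPowerSeries (Fin 3) k ⧸ P'.comap (substAlgHom ha : MvPowerSeries (Fin 3) k →ₐ[k] MvPowerSeries (Fin 3) k)) = 1 ∧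
      ∀ f : MvPowerSeries (Fin 3) k, branchVal (P'.comap (substAlgHom ha : MvPowerSeries (Fin 3) k →ₐ[k] MvPowerSeries (Fin 3) k)) f = branchVal P' (subst ![X 0 * X 1, X 1, X 1 * X 2] f) :=
  branchVal_comap_substAlgHom ha 1 (by simp) (fun i => by fin_cases i <;> simp [mul_comm]) P' hdim' hX

/-- **B3 for the chart of the blow-up of the curve `V(y,u₁)`** `chartDivOne = ![X 0, X 1, X 0 * X 2]` (split v1 B4-3 spelling): above every
one-dimensional prime `P′ ∌ X 0`. -/
theorem branchVal_comap_chartDivOne (ha : HasSubst (![X 0, X 1, X 0 * X 2] : Fin 3 → MvPowerSeries (Fin 3) k))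
    (P' : Ideal (MvPowerSeries (Fin 3) k)) [P'.IsPrime] (hdim' : ringKrullDim (MvPowerSeries (Fin 3) k ⧸ P') = 1)
    (hX : (X 0 : MvPowerSeries (Fin 3) k) ∉ P') :
    ringKrullDim (MvPowerSeries (Fin 3) k ⧸ P'.comap (substAlgHom ha : MvPowerSeries (Fin 3) k →ₐ[k] MvPowerSeries (Fin 3) k)) = 1 ∧
      ∀ f : MvPowerSeries (Fin 3) k, branchVal (P'.comap (substAlgHom ha : MvPowerSeries (Fin 3) k →ₐ[k] MvPowerSeries (Fin 3) k)) f = branchVal P' (subst ![X 0, X 1, X 0 * X 2] f) :=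
  branchVal_comap_substAlgHom ha 0 (by simp) (fun i => by fin_cases i <;> simp) P' hdim' hX

/-- **B3 for the chart of the blow-up of the curve `V(y,u₂)`** `chartDivTwo = ![X 0, X 1, X 1 * X 2]` (split v1 B4-4 spelling): above every
one-dimensional prime `P′ ∌ X 1`. -/
theorem branchVal_comap_chartDivTwo (ha : HasSubst (![X 0, X 1, X 1 * X 2] : Fin 3 → MvPowerSeries (Fin 3) k))
    (P' : Ideal (MvPowerSeries (Fin 3) k)) [P'.IsPrime] (hdim' : ringKrullDim (MvPowerSeries (Fin 3) k ⧸ P') = 1)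
    (hX : (X 1 : MvPowerSeries (Fin 3) k) ∉ P') :
    ringKrullDim (MvPowerSeries (Fin 3) k ⧸ P'.comap (substAlgHom ha : MvPowerSeries (Fin 3) k →ₐ[k] MvPowerSeries (Fin 3) k)) = 1 ∧
      ∀ f : MvPowerSeries (Fin 3) k, branchVal (P'.comap (substAlgHom ha : MvPowerSeries (Fin 3) k →ₐ[k] MvPowerSeries (Fin 3) k)) f = branchVal P' (subst ![X 0, X 1, X 1 * X 2] f) :=
  branchVal_comap_substAlgHom ha 1 (by simp) (fun i => by fin_cases i <;> simp) P' hdim' hX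

end TOT2Branch

end Summit.ResolutionOfSingularities.ResolutionOfSingularities.Theorems

end
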